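import Literature.Analysis.OperatorTheory.Enflo2023.ClaimAudit
import Literature.Analysis.OperatorTheory.Enflo2023.EndToEnd
import HarnessLib

/-!
# Enflo 2023, v2 (13) p.6 with p.17 l.578–583: the residual WITH the Main-Construction move requirement (`ClaimMC`)

Source under adjudication: Per H. Enflo, *On the invariant subspace problem in Hilbert spaces*, arXiv:2305.15442
(v2, 2024), bib key `Enflo2023` — a CLAIMED proof (claimed result under adjudication).  b2b-enflo repair cell,
formaliser 2; census rows R-V15 (referee, D34) / R20.  NOTHING here proves the manuscript's theorem.

The typed Part-B residual `MCStep.Claim` (module `MCStep`) lets the next state `s'` be ANY true Main-Construction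
state (any intertwiner `V`, any radius in the window, its minimiser).  The text's Main Construction moves by (13),
`y_{n+1} = y_n + Σ_{j≥0} r_j T^j y_n`, i.e. the next orbit operator is `V_{y_{n+1}}` with `y_{n+1} = V_{y_n}(e₀ + r)` a
vector of the form `ℓ(T) y_n`, `ℓ ∈ ℓ²`.  `ClaimMC` adds exactly this requirement — `s'.V = V_{y'}` for some
`y' ∈ V_s(ℓ²)` — to the step clause.  It is the referee's `Claim'` (R-V15): closer to tex L578–L583 and STRONGER as a
hypothesis, so

* `claim_of_claimMC : ClaimMC → Claim` (drop the clause), hence `nis_of_claimMC` (the endgame from `ClaimMC`) —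
  immediate;
* `not_claimMC_of_C_lt_one`: for EVERY operator with `‖T‖ < 1` and drift constant `C < 1` the MC-move residual is
  false too (a fortiori from `MCStep.not_claim_of_C_lt_one`, the hard-window artefact of `ClaimAudit`).

* `ZeroModel.not_claimMC` / `claim_zero_and_not_claimMC`: **`T = 0` SEPARATES the two residuals.**  On an
  infinite-dimensional `H`, `MCStep.Claim 0 x₀ Vy.S 1 β (200|·|)` holds (`MCStep.claim_zero`, module `ClaimAudit`) but
  `ClaimMC 0 _ x₀ C β G` fails for every `C`, every `β > 0` and every modulus `G` that dips below `√2` near `0⁺` — in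
  particular under the endgame's hypothesis `G(E) → 0` (`not_claimMC_of_modulus`).  Mechanism: a coefficient operator
  `V` with `V ∘ S = 0 ∘ V` has rank one (`V b = b₀ • V e₀`), so an MC move (13) keeps the orbit on the line `ℂ·y_P`
  and `v_{s'} − v_P ∈ ℂ·y_P`; the side condition `⟨c, v_{s'} − v_P⟩ = 0` then forces either no move (`(εθ)` cannot
  drop) or `c ⊥ y_P = x₀ − v_P`, i.e. the angle expression of (40) equals `√2‖c‖‖x₀ − v_P‖ > G((εθ)_P)‖c‖‖x₀ − v_P‖`
  at a pivot with small `(εθ)_P` (pivot `v = 0.4x₀ + (0.24 − η)^{1/2}u`, `u ⊥ x₀`, `(εθ) = η`).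
So the referee's `Claim'` is STRICTLY stronger than the cell's `Claim` as a hypothesis schema; its satisfiability by an
operator at `C ≥ 1` is not decided here.
-/

noncomputable section

open scoped InnerProductSpace
open RCLike

namespace Literature.Analysis.OperatorTheory.Enflo2023

namespace MCStep

variable {H : Type*} [NormedAddCommGroup H] [InnerProductSpace ℂ H] [CompleteSpace H]

/-- **The residual with the MC-move requirement** (referee's `Claim'`, census R-V15/R20): as `MCStep.Claim T x₀ Vy.S C β G`,
but the next state's orbit operator must be `V_{y'}` for a vector `y' = V_s r`, `r ∈ ℓ²` — the Main-Construction
move (13) `y_{n+1} = Σ_j (δ_{j0} + r_j) T^j y_n`.  A HYPOTHESIS, never a theorem.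
[cite: Enflo2023, v2 (13) p.6; p.17 l.578–583; (40), (45), (46) p.18–19] -/
def ClaimMC (T : H →L[ℂ] H) (hT : ‖T‖ < 1) (x₀ : H) (C β : ℝ) (G : ℝ → ℝ) : Prop :=
  ∀ P : State T x₀ Vy.S, ∃ c : H, c ≠ 0 ∧
    ‖((‖x₀ - P.v‖ : ℝ) : ℂ) • c - ((‖c‖ : ℝ) : ℂ) • (x₀ - P.v)‖ ≤ G P.etheta * (‖c‖ * ‖x₀ - P.v‖) ∧
    ∀ s : State T x₀ Vy.S, InvP C P c s →
      ∃ s' : State T x₀ Vy.S, (∃ r : Vy.ℓ2, s'.V = Vy.V T hT (s.V r)) ∧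
        s'.etheta ≤ (1 - β) * s.etheta ∧ ⟪c, s'.v - s.v⟫_ℂ = 0 ∧
        |re ⟪x₀, s'.v - s.v⟫_ℂ| ≤ C * β * s.etheta

/-- `ClaimMC ⇒ Claim`: forgetting the MC-move requirement. [cite: Enflo2023, v2 p.17 l.578–583] -/
theorem claim_of_claimMC {T : H →L[ℂ] H} {hT : ‖T‖ < 1} {x₀ : H} {C β : ℝ} {G : ℝ → ℝ}
    (h : ClaimMC T hT x₀ C β G) : Claim T x₀ Vy.S C β G := by
  intro P
  obtain ⟨c, hc, hang, hstep⟩ := h P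
  refine ⟨c, hc, hang, fun s hs => ?_⟩
  obtain ⟨s', -, h1, h2, h3⟩ := hstep s hs
  exact ⟨s', h1, h2, h3⟩

/-- The endgame from the MC-move residual: `ClaimMC` (with the standing hypotheses on `C, β, G`) gives a non-trivial
closed invariant subspace — via `claim_of_claimMC` and `MCStep.nis_of_claim`. [cite: Enflo2023, v2 p.17–22, (11)] -/
theorem nis_of_claimMC (T : H →L[ℂ] H) (hT : ‖T‖ < 1) (x₀ : H) (hx₀ : ‖x₀‖ = 1) {C β : ℝ} (hC : 0 ≤ C)
    (hβ : 0 < β) (hβ1 : β ≤ 1) (G : ℝ → ℝ) (hG0 : ∀ x, 0 ≤ G x)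
    (hG : ∀ η : ℝ, 0 < η → ∃ δ : ℝ, 0 < δ ∧ ∀ x, 0 ≤ x → x ≤ δ → G x ≤ η) (hclaim : ClaimMC T hT x₀ C β G) :
    HasNontrivialClosedInvariantSubspace T :=
  nis_of_claim T hT x₀ hx₀ hC hβ hβ1 G hG0 hG (claim_of_claimMC hclaim)

/-- The hard-window artefact transfers a fortiori: for EVERY operator with `‖T‖ < 1`, unit `x₀`, `β > 0`, any `G`,
and drift constant `C < 1`, the MC-move residual is false. [cite: Enflo2023, v2 (45) p.19; p.5 l.152] -/
theorem not_claimMC_of_C_lt_one (T : H →L[ℂ] H) (hT : ‖T‖ < 1) (x₀ : H) (hx₀ : ‖x₀‖ = 1)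
    {C β : ℝ} (hC : C < 1) (hβ : 0 < β) (G : ℝ → ℝ) :
    ¬ ClaimMC T hT x₀ C β G :=
  fun h => not_claim_of_C_lt_one T hT x₀ hx₀ hC hβ G (claim_of_claimMC h)

namespace ZeroModel

/-! ### `T = 0` separates `ClaimMC` from `Claim` -/

omit [CompleteSpace H] in
/-- Head/shift splitting of a coefficient sequence: `b = b₀e₀ + S(Lb)`. [cite: Enflo2023, v2 (2), (9), p.2–4] -/
lemma decomp_head (b : Vy.ℓ2) : b = (b 0) • lp.single 2 0 (1 : ℂ) + Vy.S (Vy.L b) := by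
  refine lp.ext (funext fun j => ?_)
  rcases j with _ | j
  · simp [lp.coeFn_smul, lp.single_apply]
  · simp [lp.coeFn_smul, lp.single_apply]

omit [CompleteSpace H] in
/-- For a state of `T = 0` the coefficient operator has rank one: `V b = b₀ • V e₀` (from `V ∘ S = 0 ∘ V`).
[cite: Enflo2023, v2 (2), (9), p.2–4] -/
lemma State_V_apply_of_zero {x₀ : H} (P : State (0 : H →L[ℂ] H) x₀ Vy.S) (b : Vy.ℓ2) :
    P.V b = (b 0) • P.V (lp.single 2 0 (1 : ℂ)) := by
  conv_lhs => rw [decomp_head b]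
  rw [map_add, map_smul, P.hVS]
  simp

/-- **`T = 0` does not satisfy the MC-move residual**: on an infinite-dimensional `H`, for every `C`, every `β > 0` and
every modulus `G` with `G < √2` on some `[0, δ]`, `¬ ClaimMC 0 _ x₀ C β G`.  (Pivot: `v = 0.4x₀ + (0.24 − η)^{1/2}u`,
`u ⊥ x₀` unit, `(εθ) = η = min(δ, 1/100)`; the MC move keeps `v_{s'} − v_P ∈ ℂ·(x₀ − v_P)`.)
[cite: Enflo2023, v2 (13) p.6; (40) p.18; (46) p.19] -/
theorem not_claimMC (hH : ¬ FiniteDimensional ℂ H) (x₀ : H) (hx₀ : ‖x₀‖ = 1)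
    (hT : ‖(0 : H →L[ℂ] H)‖ < 1) {C β : ℝ} (hβ : 0 < β) (G : ℝ → ℝ)
    (hG : ∃ δ : ℝ, 0 < δ ∧ ∀ x, 0 ≤ x → x ≤ δ → G x < Real.sqrt 2) :
    ¬ ClaimMC (0 : H →L[ℂ] H) hT x₀ C β G := by
  intro hclaim
  obtain ⟨δ, hδ, hGδ⟩ := hG
  set η : ℝ := min δ (1 / 100) with hη
  have hη0 : 0 < η := lt_min hδ (by norm_num)
  have hηδ : η ≤ δ := min_le_left _ _
  have hη1 : η ≤ 1 / 100 := min_le_right _ _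
  obtain ⟨u, hu1, hxu, -, -⟩ := exists_unit_orth3 hH x₀ x₀ x₀
  have hux : ⟪u, x₀⟫_ℂ = 0 := by rw [← inner_conj_symm, hxu, map_zero]
  set t : ℝ := Real.sqrt (0.24 - η) with ht
  have ht0 : 0 ≤ t := Real.sqrt_nonneg _
  have ht2 : t ^ 2 = 0.24 - η := Real.sq_sqrt (by linarith)
  set v : H := ((0.4 : ℝ) : ℂ) • x₀ + ((t : ℝ) : ℂ) • u with hv
  have hvx : ⟪v, x₀⟫_ℂ = ((0.4 : ℝ) : ℂ) := by
    rw [hv, inner_add_left, inner_smul_left, inner_smul_left, inner_self_eq_norm_sq_to_K, hx₀, hux,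
      Complex.conj_ofReal, Complex.conj_ofReal]
    push_cast; ring
  have hnv : ‖v‖ ^ 2 = 0.4 - η := by
    have hin : ⟪((0.4 : ℝ) : ℂ) • x₀, ((t : ℝ) : ℂ) • u⟫_ℂ = 0 := by
      rw [inner_smul_left, inner_smul_right, hxu, mul_zero, mul_zero]
    rw [hv, norm_add_sq (𝕜 := ℂ), hin, map_zero, mul_zero, add_zero, norm_smul, norm_smul, hx₀, hu1,
      Complex.norm_real, Complex.norm_real, Real.norm_eq_abs, Real.norm_eq_abs,
      abs_of_nonneg (by norm_num : (0:ℝ) ≤ 0.4), abs_of_nonneg ht0, mul_one, mul_one, ht2]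
    ring
  have hw1 : (0.3 : ℝ) ≤ ‖v‖ := by nlinarith [norm_nonneg v, hnv, hη1]
  have hw2 : ‖v‖ ≤ 0.7 := by nlinarith [norm_nonneg v, hnv, hη0]
  have hreal : (⟪v, x₀⟫_ℂ).im = 0 := by rw [hvx, Complex.ofReal_im]
  have hpos : ‖v‖ ^ 2 ≤ (⟪v, x₀⟫_ℂ).re := by rw [hvx, Complex.ofReal_re, hnv]; linarith
  obtain ⟨P, hPv⟩ := exists_state x₀ hx₀ v ⟨hw1, hw2⟩ hreal hpos
  have hεP : P.etheta = η := by
    have h := P.re_inner_v_x₀ hx₀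
    rw [hPv, hvx, Complex.ofReal_re, hnv] at h
    linarith
  obtain ⟨c, hc0, hang, hstep⟩ := hclaim P
  obtain ⟨s', ⟨r, hV'⟩, h1, h2, -⟩ := hstep P (invP_self' C P c)
  -- the rank-one structure of `T = 0` states
  set y : H := P.V (lp.single 2 0 (1 : ℂ)) with hy
  have hw : x₀ - P.v = (P.a 0) • y := by rw [P.sub_v, State_V_apply_of_zero P P.a]
  have hPr : P.V r = (r 0) • y := State_V_apply_of_zero P r
  have hs'v : s'.v = x₀ - (s'.a 0 * r 0) • y := by
    show x₀ - s'.V s'.a = _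
    rw [hV', Vy.V_decomp, hPr, smul_smul]
    simp
  have hdiff : s'.v - P.v = (P.a 0 - s'.a 0 * r 0) • y := by
    have e : s'.v - P.v = (x₀ - P.v) - (s'.a 0 * r 0) • y := by rw [hs'v]; abel
    rw [e, hw, sub_smul]
  rw [hdiff, inner_smul_right, mul_eq_zero] at h2
  rcases h2 with hκ | hcy
  · -- no move: `v_{s'} = v_P`, so `(εθ)` cannot drop
    have hveq : s'.v = P.v := by rw [← sub_eq_zero, hdiff, hκ, zero_smul]
    have e1 := s'.re_inner_v_x₀ hx₀
    have e2 := P.re_inner_v_x₀ hx₀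
    rw [hveq] at e1
    have hee : s'.etheta = P.etheta := by linarith
    rw [hee, hεP] at h1
    nlinarith [mul_pos hβ hη0]
  · -- `c ⊥ y_P = x₀ − v_P`: the angle expression is `√2‖c‖‖x₀ − v_P‖`
    have hcw : ⟪c, x₀ - P.v⟫_ℂ = 0 := by rw [hw, inner_smul_right, hcy, mul_zero]
    have hwpos : 0 < ‖x₀ - P.v‖ := by
      have h1' := norm_sub_norm_le x₀ P.v
      have h2' : ‖P.v‖ ≤ 0.7 := (P.window hx₀).2
      rw [hx₀] at h1'
      linarith
    have hcpos : 0 < ‖c‖ := norm_pos_iff.2 hc0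
    have hsq : ‖((‖x₀ - P.v‖ : ℝ) : ℂ) • c - ((‖c‖ : ℝ) : ℂ) • (x₀ - P.v)‖ ^ 2
        = 2 * (‖c‖ * ‖x₀ - P.v‖) ^ 2 := by
      rw [norm_sub_sq (𝕜 := ℂ), norm_smul, norm_smul, inner_smul_left, inner_smul_right, hcw, mul_zero,
        mul_zero, map_zero, mul_zero, sub_zero, Complex.norm_real, Complex.norm_real, Real.norm_eq_abs,
        Real.norm_eq_abs, abs_of_nonneg (norm_nonneg _), abs_of_nonneg (norm_nonneg _)]
      ring
    rw [hεP] at hang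
    have hGη := hGδ η hη0.le hηδ
    have hprod : 0 < ‖c‖ * ‖x₀ - P.v‖ := mul_pos hcpos hwpos
    have hlt : ‖((‖x₀ - P.v‖ : ℝ) : ℂ) • c - ((‖c‖ : ℝ) : ℂ) • (x₀ - P.v)‖
        < Real.sqrt 2 * (‖c‖ * ‖x₀ - P.v‖) :=
      hang.trans_lt (mul_lt_mul_of_pos_right hGη hprod)
    have h0 : 0 ≤ ‖((‖x₀ - P.v‖ : ℝ) : ℂ) • c - ((‖c‖ : ℝ) : ℂ) • (x₀ - P.v)‖ := norm_nonneg _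
    have hss := mul_self_lt_mul_self h0 hlt
    have hR : (Real.sqrt 2 * (‖c‖ * ‖x₀ - P.v‖)) ^ 2 = 2 * (‖c‖ * ‖x₀ - P.v‖) ^ 2 := by
      rw [mul_pow, Real.sq_sqrt (by norm_num : (0:ℝ) ≤ 2)]
    rw [← sq, ← sq, hsq, hR] at hss
    exact lt_irrefl _ hss

/-- Under the endgame's modulus hypothesis `G(E) → 0` (`E → 0⁺`) — the `hG` of `MCStep.nis_of_claimMC` — the MC-move
residual fails for `T = 0` (infinite-dimensional `H`, any `C`, any `β > 0`). [cite: Enflo2023, v2 (13) p.6; (40) p.18] -/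
theorem not_claimMC_of_modulus (hH : ¬ FiniteDimensional ℂ H) (x₀ : H) (hx₀ : ‖x₀‖ = 1)
    (hT : ‖(0 : H →L[ℂ] H)‖ < 1) {C β : ℝ} (hβ : 0 < β) (G : ℝ → ℝ)
    (hG : ∀ η : ℝ, 0 < η → ∃ δ : ℝ, 0 < δ ∧ ∀ x, 0 ≤ x → x ≤ δ → G x ≤ η) :
    ¬ ClaimMC (0 : H →L[ℂ] H) hT x₀ C β G := by
  obtain ⟨δ, hδ, h⟩ := hG 1 one_pos
  have h12 : (1 : ℝ) < Real.sqrt 2 := by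
    rw [show (1 : ℝ) = Real.sqrt 1 from Real.sqrt_one.symm]
    exact Real.sqrt_lt_sqrt (by norm_num) (by norm_num)
  exact not_claimMC hH x₀ hx₀ hT hβ G ⟨δ, hδ, fun x hx hxδ => (h x hx hxδ).trans_lt h12⟩

end ZeroModel

/-- **`T = 0` separates the residuals**: with `C = 1`, `0 < β ≤ 1`, `G = 200|·|` on an infinite-dimensional `H`, the
cell's `Claim` holds (`claim_zero`) and the referee's `ClaimMC` fails — the MC-move requirement (13) is STRICTLY
stronger as a hypothesis schema. [cite: Enflo2023, v2 (13) p.6; p.17 l.578–583] -/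
theorem claim_zero_and_not_claimMC (hH : ¬ FiniteDimensional ℂ H) (x₀ : H) (hx₀ : ‖x₀‖ = 1)
    (hT : ‖(0 : H →L[ℂ] H)‖ < 1) {β : ℝ} (hβ0 : 0 < β) (hβ1 : β ≤ 1) :
    Claim (0 : H →L[ℂ] H) x₀ Vy.S 1 β (fun E => 200 * |E|) ∧
      ¬ ClaimMC (0 : H →L[ℂ] H) hT x₀ 1 β (fun E => 200 * |E|) := by
  refine ⟨claim_zero hH x₀ hx₀ hβ0.le hβ1, ZeroModel.not_claimMC hH x₀ hx₀ hT hβ0 _ ⟨1 / 200, by norm_num, ?_⟩⟩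
  intro x hx hxδ
  have h12 : (1 : ℝ) < Real.sqrt 2 := by
    rw [show (1 : ℝ) = Real.sqrt 1 from Real.sqrt_one.symm]
    exact Real.sqrt_lt_sqrt (by norm_num) (by norm_num)
  calc 200 * |x| = 200 * x := by rw [abs_of_nonneg hx]
    _ ≤ 1 := by linarith
    _ < Real.sqrt 2 := h12

end MCStep

end Literature.Analysis.OperatorTheory.Enflo2023

end
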